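import Summits.HodgeConjecture.HodgeConjecture.Theorems.Ring2HypothesesWeilComponentsCMLadder
import Summits.HodgeConjecture.HodgeConjecture.Theorems.Ring2TransportWeilTypeEveryCMFieldClosed
import Summits.HodgeConjecture.HodgeConjecture.Theorems.Ring2TransportWeilClasses
import Summits.HodgeConjecture.HodgeConjecture.Theorems.WeilTypeLadderCMReduction
import Literature.AlgebraicGeometry.Deligne1982.WeilTypeCMOfCMField
import HarnessLib

/-!
# Ring 2 — hypotheses layer, part XV: Deligne's carriers are EXACTLY as strong as the ladder's CM-field rung (R3⁺ ⟺ R3)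

HONEST FRAMING: research route conditional on HC_CM; not a corollary; Q11.4-sentence-2 already refuted in dim ≥ 3.

Cell `pub-hodge-ring2`, seat `pub-hodge-ring2-typer2`, gen 10; companion of parts VII-C / VII-D
(`Ring2HypothesesWeilComponentsCM[Ladder]`). `HC_CM` is the binder `(hCM : Theses.RankFourFaces.CMAbelianHodge)`
(item stmt-HodgeConjecture-3052) BY NAME wherever it occurs; theorems only (no new `def`, no fact minted).

## What this file adds

Part VII-C rendered the ladder's rung R3 (`WeilTypeLadder.WeilClassesCMField`: algebraicity of the rational Weil
classes `W_K` for a CM field `K = ℚ(φ) ≅ ℚ[T]/(P)`, `[K:ℚ] = e > 2`) on Deligne's carriers `IsWeilTypeCM A η R e₀ k`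
(`E = ℚ(η)`, `η̄ = -η`, minimal polynomial `R(T²)`, `e₀ ≥ 2`) as `WeilClassesWeilTypeCM` ("R3⁺"), and part VII-D
proved R3 ⟹ R3⁺ (`weilClassesWeilTypeCM_of_weilClassesCMField`). The converse needed a CHANGE OF GENERATOR of the
CM field on the spectral carrier; the literature seat has now proved it (`Deligne1982.exists_isWeilTypeCM_of_cmField`:
every R3 datum with balanced multiplicities admits Deligne's presentation `η = S(φ)`, `η̄ = -η`, with EQUAL Weil
spaces; `Deligne1982.weilClassesField_cmField_mem_algebraicClasses_of_weilTypeCM`: the ∀-body of R3⁺ implies the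
∀-body of R3, the unbalanced data being disposed of by the Moonen–Zarhin criterion, a tree THEOREM). Hence:

* §1 **R3⁺ ⟺ R3** (`weilClassesWeilTypeCM_iff_weilClassesCMField`): every statement of parts VII-C/VII-D/XI-B and
  of the transport seat's T6-CM column that is phrased over `IsWeilTypeCM` is EXACTLY as strong as its R3-form.
* §2 **R3 ⟺ the conjunction of ALL CM-field δ-components** `WeilClassesComponentCM R e₀ k δ` (`e₀ ≥ 2`), granted the
  typed supply statement `PolarizedWeilDiscriminantCMExists` (Deligne p. 30 (1) / Lemma 4.6 / Thm. 4.8 (a), typed,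
  never asserted): the δ-ladder of part VII-C is exact AGAINST THE LADDER RUNG ITSELF, not only against R3⁺.
* §3 **R3 reached from the δ-REFINED transport inputs**: `HC_CM` + CM-pointed δ-families + δ-VHC for every component
  ⟹ R3 (row W1-CM-Σ, `HC_CM` NOMINAL), and the `HC_CM`-FREE twin from divisor-generated CM anchors (W1′-CM-Σ) — the
  per-component refinements of the transport seat's `HC_WeilClassesCMField_of_HC_CM` (which takes the GLOBAL leaves
  `CMPointedWeilFamiliesCMField` / `WeilVariationalHodgeCMField`).
* §4 **André's converse and the T6 ladder row on Deligne's carriers**: granted André 1992 (tree fact, direction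
  Weil ⟹ CM), `R∞ ∧ R3⁺ ⟹ HC_CM`; granted the four global transport leaves, `HC_CM ⟺ R∞ ∧ R3⁺`; and the closed-form
  ladder row `(#24) → R∞ → R3⁺ → HodgeGeneralWeilTypeEveryCMField`.

Honest column: nothing here makes a class algebraic; R3, R3⁺, every δ-component, every δ-VHC leaf and the supply
statement stay OPEN; fact #24 (Milne's endnote 16) is UNREFEREED for `e₀ ≥ 2`; André 1992 is a refereed THEOREM used as
a named hypothesis. NOT claimed: a variational converse (all δ-VHC-CM leaves ⟹ R3var) — the presentation is per
variety (`∃ S R`), a family would need ONE `(R, δ)` for all fibres, which neither the tree nor print supplies.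

## References

* [Deligne1982HodgeCycles] P. Deligne, Hodge cycles on abelian varieties, LNM 900 (1982), §4: p. 30 (`E = F(η)`,
  `η̄ = -η`; (1)), (4.4), Prop. 4.4, Lemma 4.6, Thm. 4.8; §5; Milne 2003 re-edition endnote 16 (UNREFEREED).
* [MoonenZarhin1998WeilClasses] B. Moonen, Yu. Zarhin, Weil classes on abelian varieties, J. reine angew. Math. 496
  (1998) 83–92, §1 (`W_F`, `n_σ`, Criterion).
* [Andre1992HodgeCM] Y. André, Une remarque à propos des cycles de Hodge de type CM, Sém. Théorie des Nombres Paris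
  1989–90, Progr. Math. 102 (1992) 1–7, Théorème.
* [vanGeemen1994HodgeAV] B. van Geemen, An introduction to the Hodge conjecture for abelian varieties, LNM 1594 (1994),
  Thm. 4.11, Thm. 6.12. [CharlesSchnell2014Notes] Conj. 11.3.1. [Markman2025SurveySecant] §12 (UNREFEREED).
-/

set_option linter.dupNamespace false

noncomputable section

open CategoryTheory
open Literature.AlgebraicGeometry Literature.AlgebraicGeometry.Motives
open Literature.AlgebraicGeometry.HodgeTheory
open Literature.AlgebraicGeometry.Deligne1982
open Literature.AlgebraicTopology.SingularHomology
open Summit.HodgeConjecture.HodgeConjecture.WeilTypeLadder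
open Summit.HodgeConjecture.HodgeConjecture.Theses
open Summit.HodgeConjecture.HodgeConjecture.Ring2Transport

namespace Summit.HodgeConjecture.HodgeConjecture.Ring2.Hypotheses

/-! ### §1 R3⁺ ⟺ R3 -/

/-- **R3⁺ ⟹ R3: rung R3 on Deligne's carriers implies the ladder's CM-field rung.** For an R3 datum `(A, φ, P, e, m)`
(`P` monic irreducible of degree `e > 2`, no real root, a conjugation polynomial `Q`): `m = 0` is trivial; if the
multiplicities `n_ρ` are unbalanced the only rational `(m,m)` class of `W_K` is `0` (Moonen–Zarhin Criterion (ii), tree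
theorem); if they are balanced, `η = S(φ) ∈ ℤ[φ]` with `η̄ = -η`, minimal polynomial `R(T²)`, `e = 2e₀`, gives
`IsWeilTypeCM A η R e₀ m` with the SAME Weil space, and R3⁺ applies (`e₀ ≥ 2` as `e > 2`). The whole argument is the
Literature theorem `Deligne1982.weilClassesField_cmField_mem_algebraicClasses_of_weilTypeCM`, stated on the two
∀-bodies. [cite: Deligne1982HodgeCycles, §4 (4.4), Prop. 4.4 and p. 30] [cite: MoonenZarhin1998WeilClasses, §1 (Criterion)] -/
theorem weilClassesCMField_of_weilClassesWeilTypeCM (h : WeilClassesWeilTypeCM) : WeilClassesCMField :=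
  fun A φ P e m hPm hPe he hPirr hφ hdim hnr hQ ↦
    weilClassesField_cmField_mem_algebraicClasses_of_weilTypeCM h A φ P e m hPm hPe he hPirr hφ hdim hnr hQ

/-- **R3⁺ ⟺ R3 — Deligne's carriers are EXACTLY as strong as the ladder's CM-field rung.** (`→` this file; `←` part
VII-D `weilClassesWeilTypeCM_of_weilClassesCMField`, the transport seat's junction `weilClassesCMField_isWeilTypeCM`.)
[cite: Deligne1982HodgeCycles, §4 (4.4) and p. 30] [cite: MoonenZarhin1998WeilClasses, §1] -/
theorem weilClassesWeilTypeCM_iff_weilClassesCMField : WeilClassesWeilTypeCM ↔ WeilClassesCMField :=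
  ⟨weilClassesCMField_of_weilClassesWeilTypeCM, weilClassesWeilTypeCM_of_weilClassesCMField⟩

/-! ### §2 R3 against the δ-components of part VII-C -/

/-- R3 ⟹ every CM-field δ-component (`e₀ ≥ 2`). [cite: Deligne1982HodgeCycles, §4 p. 30 (1)] -/
theorem weilClassesByComponentCM_of_weilClassesCMField (h : WeilClassesCMField) : WeilClassesByComponentCM :=
  weilClassesByComponentCM_of_weilClassesWeilTypeCM (weilClassesWeilTypeCM_of_weilClassesCMField h)

/-- R3 ⟹ ONE component `(E = ℚ[T]/(R(T²)), 2k, δ)`. [cite: Deligne1982HodgeCycles, §4 p. 30 (1)] -/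
theorem weilClassesComponentCM_of_weilClassesCMField {R : Polynomial ℤ} [Fact (Irreducible (realPolyQ R))]
    {e₀ k : ℕ} (h : WeilClassesCMField) (he : 2 ≤ e₀) (δ : cmNormResidueGroup R) :
    WeilClassesComponentCM R e₀ k δ :=
  weilClassesComponentCM_of_weilClassesWeilTypeCM (weilClassesWeilTypeCM_of_weilClassesCMField h) he δ

/-- **All δ-components ⟹ R3**, granted the typed supply statement (every Weil-type CM datum carries a Rosati-compatible
polarization with discriminant data of some class `δ`). [cite: Deligne1982HodgeCycles, §4 p. 30 (1), Lemma 4.6 and Thm. 4.8 (a)] -/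
theorem weilClassesCMField_of_byComponentCM (hE : PolarizedWeilDiscriminantCMExists)
    (h : WeilClassesByComponentCM) : WeilClassesCMField :=
  weilClassesCMField_of_weilClassesWeilTypeCM (weilClassesWeilTypeCM_of_byComponentCM hE h)

/-- **W3-CM against the LADDER rung — exactness of the δ-indexing**: granted `PolarizedWeilDiscriminantCMExists`
(typed, open), rung R3 `WeilClassesCMField` is EQUIVALENT to the conjunction of the CM-field component targets
`WeilClassesComponentCM R e₀ k δ` over all `(R, e₀ ≥ 2, k, δ)`. (Part VII-D proved this against R3⁺ only.)
[cite: Deligne1982HodgeCycles, §4 p. 30 (1) and Lemma 4.6] [cite: MoonenZarhin1998WeilClasses, §1] -/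
theorem weilClassesCMField_iff_byComponentCM (hE : PolarizedWeilDiscriminantCMExists) :
    WeilClassesCMField ↔ WeilClassesByComponentCM :=
  ⟨weilClassesByComponentCM_of_weilClassesCMField, weilClassesCMField_of_byComponentCM hE⟩

/-! ### §3 R3 from the δ-refined transport inputs (rows W1-CM-Σ / W1′-CM-Σ / anchored-Σ) -/

/-- **Row W1-CM-Σ — rung R3 from `HC_CM`, a CM-pointed `(E, 2k, δ)`-Weil family through every polarized member of
every component, and the δ-restricted Weil-confined variational Hodge statement of every component** (granted the
typed supply statement). The per-component refinement of the transport seat's `HC_WeilClassesCMField_of_HC_CM` (global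
leaves); CONDITIONAL on the four named hypotheses; `HC_CM` NOMINAL (next row). [cite: Deligne1982HodgeCycles, §4 proof of Thm. 4.8 (a)–(c) and §5]
[cite: CharlesSchnell2014Notes, Conj. 11.3.1] [cite: Mumford1969NoteShimura, §3] -/
theorem HC_WeilClassesCMField_of_HC_CM_of_componentsCM (hCM : Theses.RankFourFaces.CMAbelianHodge)
    (hE : PolarizedWeilDiscriminantCMExists)
    (hP : ∀ (R : Polynomial ℤ) [Fact (Irreducible (realPolyQ R))] (e₀ k : ℕ) (δ : cmNormResidueGroup R), 2 ≤ e₀ →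
      CMPointedWeilFamiliesComponentCM R e₀ k δ)
    (hV : ∀ (R : Polynomial ℤ) [Fact (Irreducible (realPolyQ R))] (e₀ k : ℕ) (δ : cmNormResidueGroup R), 2 ≤ e₀ →
      WeilVariationalHodgeComponentCM R e₀ k δ) :
    WeilClassesCMField :=
  weilClassesCMField_of_byComponentCM hE fun R _ e₀ k δ he ↦
    weilClassesComponentCM_of_HC_CM hCM (hP R e₀ k δ he) (hV R e₀ k δ he)

/-- **Row W1′-CM-Σ — the same rung WITHOUT `HC_CM`**, from δ-families pointed at a DIVISOR-GENERATED CM fibre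
(Deligne §5: members isogenous to powers of CM abelian varieties with `Hdg = Div` on every component; typed leaf
`DivisorGeneratedCMPointedWeilFamiliesComponentCM`). [cite: Deligne1982HodgeCycles, §5] [cite: CharlesSchnell2014Notes, Conj. 11.3.1] -/
theorem weilClassesCMField_of_divisorGeneratedCMPointed_componentsCM (hE : PolarizedWeilDiscriminantCMExists)
    (hP : ∀ (R : Polynomial ℤ) [Fact (Irreducible (realPolyQ R))] (e₀ k : ℕ) (δ : cmNormResidueGroup R), 2 ≤ e₀ →
      DivisorGeneratedCMPointedWeilFamiliesComponentCM R e₀ k δ)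
    (hV : ∀ (R : Polynomial ℤ) [Fact (Irreducible (realPolyQ R))] (e₀ k : ℕ) (δ : cmNormResidueGroup R), 2 ≤ e₀ →
      WeilVariationalHodgeComponentCM R e₀ k δ) :
    WeilClassesCMField :=
  weilClassesCMField_of_byComponentCM hE fun R _ e₀ k δ he ↦
    weilClassesComponentCM_of_divisorGeneratedCMPointed (hP R e₀ k δ he) (hV R e₀ k δ he)

/-- **Anchored-Σ — rung R3 from the ANCHORED δ-leaves and the δ-VHC of every component** (both cases of the summit),
granted the supply statement. [cite: CharlesSchnell2014Notes, Conj. 11.3.1] [cite: Markman2025SurveySecant, §12] -/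
theorem weilClassesCMField_of_anchored_componentsCM (hE : PolarizedWeilDiscriminantCMExists)
    (hP : ∀ (R : Polynomial ℤ) [Fact (Irreducible (realPolyQ R))] (e₀ k : ℕ) (δ : cmNormResidueGroup R), 2 ≤ e₀ →
      AnchoredWeilFamiliesComponentCM R e₀ k δ)
    (hV : ∀ (R : Polynomial ℤ) [Fact (Irreducible (realPolyQ R))] (e₀ k : ℕ) (δ : cmNormResidueGroup R), 2 ≤ e₀ →
      WeilVariationalHodgeComponentCM R e₀ k δ) :
    WeilClassesCMField :=
  weilClassesCMField_of_byComponentCM hE fun R _ e₀ k δ he ↦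
    weilClassesComponentCM_of_anchored_of_variational (hP R e₀ k δ he) (hV R e₀ k δ he)

/-! ### §4 André's converse and the T6 ladder row, on Deligne's carriers -/

/-- **André's arrow on Deligne's carriers: `[André 1992] → R∞ → R3⁺ → HC_CM`.** Granted André's theorem (every Hodge
class on a CM abelian variety lies in the span of pull-backs of Weil classes; refereed, used as the named Literature
statement), the two top rungs — the imaginary-quadratic rung R∞ and rung R3 ON DELIGNE'S CARRIERS — PROVE `HC_CM`
(tree arrow `rankFourFaces_cmAbelianHodge_of_andre_of_rungs` + §1). So the cell's direction `HC_CM ⇒ R3⁺` is the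
CONVERSE of the printed one, exactly as for R3. [cite: Andre1992HodgeCM, Théorème] [cite: vanGeemen1994HodgeAV, Thm. 4.11] -/
theorem hc_cm_of_andre_of_quadratic_of_weilClassesWeilTypeCM
    (hA : Andre1992_hodgeClasses_cmAbelianVariety_mem_span_pullback_weilClasses)
    (h₂ : WeilClassesImaginaryQuadratic) (h₃ : WeilClassesWeilTypeCM) : Theses.RankFourFaces.CMAbelianHodge :=
  rankFourFaces_cmAbelianHodge_of_andre_of_rungs hA h₂ (weilClassesCMField_of_weilClassesWeilTypeCM h₃)

/-- **Granted André 1992 and the four GLOBAL transport leaves, `HC_CM ⟺ R∞ ∧ R3⁺`** (the transport seat's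
`HC_CM_iff_weilRungs_of_andre_of_transport` with R3 replaced by its Deligne-carrier form, §1).
[cite: Andre1992HodgeCM, Théorème] [cite: CharlesSchnell2014Notes, Conj. 11.3.1] [cite: Deligne1982HodgeCycles, §4 proof of Thm. 4.8 and §5] -/
theorem HC_CM_iff_quadratic_and_weilClassesWeilTypeCM_of_andre_of_transport
    (hA : Andre1992_hodgeClasses_cmAbelianVariety_mem_span_pullback_weilClasses)
    (hP₂ : CMPointedWeilFamiliesQuadratic) (hV₂ : WeilVariationalHodgeQuadratic)
    (hP₃ : CMPointedWeilFamiliesCMField) (hV₃ : WeilVariationalHodgeCMField) :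
    Theses.RankFourFaces.CMAbelianHodge ↔ WeilClassesImaginaryQuadratic ∧ WeilClassesWeilTypeCM := by
  rw [weilClassesWeilTypeCM_iff_weilClassesCMField]
  exact HC_CM_iff_weilRungs_of_andre_of_transport hA hP₂ hV₂ hP₃ hV₃

/-- **Granted André 1992, the supply statement and the δ-REFINED transport inputs of §3 plus the quadratic global
leaves, `HC_CM ⟺ R∞ ∧ R3`.** [cite: Andre1992HodgeCM, Théorème] [cite: CharlesSchnell2014Notes, Conj. 11.3.1]
[cite: Deligne1982HodgeCycles, §4 proof of Thm. 4.8, p. 30 (1) and §5] -/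
theorem HC_CM_iff_weilRungs_of_andre_of_componentsCM
    (hA : Andre1992_hodgeClasses_cmAbelianVariety_mem_span_pullback_weilClasses)
    (hP₂ : CMPointedWeilFamiliesQuadratic) (hV₂ : WeilVariationalHodgeQuadratic)
    (hE : PolarizedWeilDiscriminantCMExists)
    (hP : ∀ (R : Polynomial ℤ) [Fact (Irreducible (realPolyQ R))] (e₀ k : ℕ) (δ : cmNormResidueGroup R), 2 ≤ e₀ →
      CMPointedWeilFamiliesComponentCM R e₀ k δ)
    (hV : ∀ (R : Polynomial ℤ) [Fact (Irreducible (realPolyQ R))] (e₀ k : ℕ) (δ : cmNormResidueGroup R), 2 ≤ e₀ →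
      WeilVariationalHodgeComponentCM R e₀ k δ) :
    Theses.RankFourFaces.CMAbelianHodge ↔ WeilClassesImaginaryQuadratic ∧ WeilClassesCMField :=
  ⟨fun hCM ↦ ⟨HC_WeilClassesQuadratic_of_HC_CM hCM hP₂ hV₂, HC_WeilClassesCMField_of_HC_CM_of_componentsCM hCM hE hP hV⟩,
    fun h ↦ rankFourFaces_cmAbelianHodge_of_andre_of_rungs hA h.1 h.2⟩

/-- **LADDER ROW on Deligne's carriers, closed form: `(#24) → R∞ → R3⁺ → HodgeGeneralWeilTypeEveryCMField`** — the
Hodge conjecture for the GENERAL Weil-type abelian variety (Hodge group `SU(V, φ)`) over EVERY CM field, from the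
algebraicity of the rational Weil classes alone (Moonen–Zarhin's criterion and the descent input being tree theorems);
no families, no `HC_CM`. Milne's endnote 16 (#24) is UNREFEREED for `[E:ℚ] > 2`.
[cite: Deligne1982HodgeCycles, §4 (4.4), Prop. 4.4 and Milne 2003 re-edition endnote 16] [cite: MoonenZarhin1998WeilClasses, §1]
[cite: vanGeemen1994HodgeAV, Thm. 6.12] -/
theorem hodgeGeneralWeilTypeEveryCMField_of_quadratic_of_weilClassesWeilTypeCM
    (h24 : Deligne1982_hodgeRing_weilTypeCM_of_hodgeGroupSU) (hRq : WeilClassesImaginaryQuadratic)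
    (h : WeilClassesWeilTypeCM) : HodgeGeneralWeilTypeEveryCMField :=
  hodgeGeneralWeilTypeEveryCMField_of_ladder_closed h24 hRq (weilClassesCMField_of_weilClassesWeilTypeCM h)

/-- **POSITION of R3⁺ after gen 10** (one conjunction a referee can quote): R3⁺ is a case of the summit and of `HC_AV`;
R3⁺ ⟺ R3; granted the supply statement R3 ⟺ all CM-field δ-components. [cite: Deligne2000, §1]
[cite: Deligne1982HodgeCycles, §4 (4.4) and p. 30 (1)] -/
theorem weilClassesWeilTypeCM_position :
    (_root_.HodgeConjecture → WeilClassesWeilTypeCM) ∧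
    (PadicSemiregularLift.HodgeAbelianVarieties → WeilClassesWeilTypeCM) ∧
    (WeilClassesWeilTypeCM ↔ WeilClassesCMField) ∧
    (PolarizedWeilDiscriminantCMExists → (WeilClassesCMField ↔ WeilClassesByComponentCM)) :=
  ⟨weilClassesWeilTypeCM_of_hodgeConjecture, weilClassesWeilTypeCM_of_hodgeAbelianVarieties,
    weilClassesWeilTypeCM_iff_weilClassesCMField, weilClassesCMField_iff_byComponentCM⟩

end Summit.HodgeConjecture.HodgeConjecture.Ring2.Hypotheses

end
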